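import Summits.Ventures.YMGap.RobustBall.UniformMassGap
import Summits.Ventures.YMGap.RobustBall.RowsSN
import HarnessLib

/-!
# Venture YMGap, track ROBUST-BALL (Y2) — tier 2: the mass gap UNIFORMLY on the weighted ball, RATE = WEIGHT

HONEST FRAMING. WHAT THIS IS: a venture file (cell `pub-ymgap`, track Y2 ROBUST-BALL, seat rb-p1, theorems
only) closing the uniform tier-2 currency `UniformMassGapOnBallZdS` of `UniformMassGap.lean` with the landed
tier-2 door `perturbed_covariance_decay_S` / `perturbedMassGapS_SU` (`SummableMassGap.lean`, Föllmer–Künsch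
comparison with the profile `dist(·, Λ₂)`), whose constants are explicit and member-independent:
* `uniformMassGapOnBallZdS_of_pair` — `d, N ≥ 1`, a one-link Poincaré/variance pair `(c, v)` on
  `‖B‖_op ≤ b ⊇ 2(d-1)|β|`, weight `t > 0`, loads `(a, Λ)` with `6(d-1)|β| e^{a} e^{t} √(c v) + e^{a/2} √c Λ < 1`
  `⇒ UniformMassGapOnBallZdS d N β a Λ t t (8N)`: EVERY member of the weighted ball has exactly one DLR state,
  and EVERY such state clusters at RATE `t` — THE WEIGHT OF THE NORM — with constant `8N n²`; schemas form,
  the hypothesis-free all-`N` Bakry–Émery form `suN_uniformMassGapOnBallZdS_bakryEmery`, and the `SU(2)` sharp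
  form `su2_uniformMassGapOnBallZdS[_dim4]` (`2(d-1)|β_W| e^{a} e^{t} + e^{a/2} √(2/3) Λ < 1 ⇒ … (β_W/4) a Λ t t 16`);
* the landed `SU(2)` `ℤ⁴` rows re-read uniformly (same certificates, `RowsS.lean` / `RowsSU2.lean` majorants):
  `su2_uniformRowS`, cells at `q = 2` — rate `log 2 ≥ 0.693` per lattice unit, constant `16 n²` — at
  `(β_W, ε) = (1/80, .470), (1/40, .346), (1/32, .294), (1/24, .219), (1/20, .167), (1/16, .097)`; lineage B
  (`su2_uniformRowBS`, sharp variance, `β_W ≤ 1/6`): `(1/40, .376), (1/32, .328), (1/24, .258), (1/20, .209),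
  (1/16, .143), (1/12, .049)`; every `N ≥ 2` at 't Hooft `1/64`: `suN_uniformRowS_1_64` (rate `log (6/5)`, `8N n²`);
* the loop-action norm ball: `su2_uniformMassGapOnLoopBall_1_16` — EVERY generic Wilson-type loop action on `ℤ⁴`
  (any family of closed loops, finite carrier fibres) with `‖c‖_{log 2} ≤ 0.143` added to `SU(2)` Wilson at
  `β_W = 1/16` has ONE DLR state whose connected correlations of Lipschitz cylinder observables decay at rate
  `≥ log 2` (correlation length `≤ 1/log 2 < 1.443` lattice units) with the SAME constant `16 n²` — one bound for
  the whole ball; `_1_20` (`0.209`), `suN_uniformMassGapOnLoopBall_1_64` (all `N`, `1/40`, rate `log (6/5)`).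
Through `UniformMassGapOnBallZdS.massGapOnBallZdS` every row re-proves its landed pointwise row.
WHAT THIS IS NOT: strong-coupling LATTICE statements (`β_W ≤ 1/16` at `q = 2`); the rate `t` is a LOWER bound
on the inverse correlation length forced by the chosen weight, not the physical mass (which at these
couplings is of order `-4 log β_W`); nothing about the continuum limit or a Clay-sense mass gap.
Certificates: `HOME/rb/certs/SU2-Z4-SINGLELINK-ROWS-rbp1.md` §tier-2 (unchanged: the row inequalities are
the landed ones).
-/

noncomputable section

open MeasureTheory Filter Function ProbabilityTheory Real Topology
open scoped NNReal
open Literature.Probability.LatticeModels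
open Literature.Probability.LatticeModels.DobrushinMetric
open Literature.MathematicalPhysics.QuantumLattice
open Literature.MathematicalPhysics.QuantumFieldTheory hiding ZdEdge Site
open Summit.QuantumFields.BalabanUV.InfraRed.StrongCouplingPoincareDoorSUN (OneLinkPoincareSUN OneLinkPoincareSUN.mono
  oneLinkPoincareSUN_two_sharp oneLinkPoincareSUN_bakryEmery)
open Summit.QuantumFields.BalabanUV.InfraRed.StrongCouplingVarianceDoorSUN (OneLinkVarianceBound
  oneLinkVarianceBound_bakryEmery)

namespace Summit.Ventures.YMGap.RobustBall

variable {d N : ℕ}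

/-! ### The uniform tier-2 theorem from a one-link pair: rate = weight, constant `8N` -/

/-- **MASS GAP UNIFORMLY ON THE TIER-2 BALL from a one-link pair — RATE = WEIGHT**: for `d, N ≥ 1`, a
Poincaré/variance pair `(c, v)` on the ball `‖B‖_op ≤ b ⊇ 2(d-1)|β|`, a weight `t > 0` and loads `(a, Λ)` with
`6(d-1)|β| e^{a} e^{t} √(c v) + e^{a/2} √c Λ < 1`: `UniformMassGapOnBallZdS d N β a Λ t t (8N)` — every member has
exactly one DLR state (`perturbedMassGapS_SU`) and every DLR state clusters at rate `t` with constant `8N n²`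
(`perturbed_covariance_decay_S`). [folklore] -/
theorem uniformMassGapOnBallZdS_of_pair (hd : 1 ≤ d) (hN : 1 ≤ N) {β b c v a Λ t : ℝ}
    (hc : 0 ≤ c) (hv : 0 ≤ v) (hb : |β| * (2 * ((d : ℝ) - 1)) ≤ b)
    (hP : ∀ B : Matrix (Fin N) (Fin N) ℂ, matrixOpNorm B ≤ b →
      ∀ (ψ : Matrix.specialUnitaryGroup (Fin N) ℂ → ℝ) (M : ℝ), 0 ≤ M →
        (∀ x y, |ψ x - ψ y| ≤ M * suFrobDist x y) →
        Var[ψ; (haarProbability (Matrix.specialUnitaryGroup (Fin N) ℂ)).tilted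
          fun g => (N : ℝ) * ((g : Matrix (Fin N) (Fin N) ℂ) * B).trace.re] ≤ c * M ^ 2)
    (hVB : ∀ B : Matrix (Fin N) (Fin N) ℂ, matrixOpNorm B ≤ b → ∀ Δ : Matrix (Fin N) (Fin N) ℂ,
      Var[fun g : Matrix.specialUnitaryGroup (Fin N) ℂ =>
          (N : ℝ) * ((g : Matrix (Fin N) (Fin N) ℂ) * Δ).trace.re;
        (haarProbability (Matrix.specialUnitaryGroup (Fin N) ℂ)).tilted
          fun g => (N : ℝ) * ((g : Matrix (Fin N) (Fin N) ℂ) * B).trace.re] ≤ v * frobNorm Δ ^ 2)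
    (ht : 0 < t)
    (hρ : 6 * ((d : ℝ) - 1) * |β| * (exp a * exp t * Real.sqrt (c * v)) + exp (a / 2) * Real.sqrt c * Λ < 1) :
    UniformMassGapOnBallZdS d N β a Λ t t (8 * N) := by
  refine ⟨ht, fun W hW => ?_⟩
  obtain ⟨B, hB⟩ := hW.summable
  obtain ⟨osc, lip, ℓ, hosc, hlip, hoscs, hosca, hlips, hℓ, hℓs, hℓt⟩ := hW.loads
  refine ⟨(perturbedMassGapS_SU hd hN hc hv hb hP hVB hB hW.continuous hW.dependsOn hosc hoscs hosca hlip
    hlips hℓ ht hℓs hℓt hρ).1, fun μ hμ n F₁ F₂ Λ₁ Λ₂ K₁ K₂ h₁ h₂ hdj hF₁ hF₂ => ?_⟩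
  have h8 : (2 * (2 * Real.sqrt N) ^ 2 : ℝ) = 8 * N := by
    rw [mul_pow, Real.sq_sqrt (Nat.cast_nonneg _)]; ring
  rw [← h8]
  exact perturbed_covariance_decay_S hd hN hc hv hb hP hVB hB hW.continuous hW.dependsOn hosc hoscs hosca hlip
    hlips hℓ ht.le hℓs hℓt hρ μ hμ n F₁ F₂ Λ₁ Λ₂ K₁ K₂ h₁ h₂ hdj hF₁ hF₂

/-- The same with the cell's NAMED one-link schemas `OneLinkPoincareSUN N b c` / `OneLinkVarianceBound N b v`. [folklore] -/
theorem uniformMassGapOnBallZdS_of_schemas (hd : 1 ≤ d) (hN : 1 ≤ N) {β b c v a Λ t : ℝ} (hc : 0 ≤ c)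
    (hv : 0 ≤ v) (hP : OneLinkPoincareSUN N b c) (hV : OneLinkVarianceBound N b v)
    (hb : |β| * (2 * ((d : ℝ) - 1)) ≤ b) (ht : 0 < t)
    (hρ : 6 * ((d : ℝ) - 1) * |β| * (exp a * exp t * Real.sqrt (c * v)) + exp (a / 2) * Real.sqrt c * Λ < 1) :
    UniformMassGapOnBallZdS d N β a Λ t t (8 * N) :=
  uniformMassGapOnBallZdS_of_pair hd hN hc hv hb (fun B hB => hP B hB) (fun B hB => hV B hB) ht hρ

/-- **ALL `N ≥ 2`, EVERY `d ≥ 1`, HYPOTHESIS-FREE — uniform tier-2 mass gap from the Bakry–Émery pair**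
(`b = 2(d-1)|β| < 1/2`): `6(d-1)|β| e^{a} e^{t}/(1/2 - b) + e^{a/2} Λ/√(N(1/2 - b)) < 1`, `t > 0`
`⇒ UniformMassGapOnBallZdS d N β a Λ t t (8N)`. [folklore] -/
theorem suN_uniformMassGapOnBallZdS_bakryEmery (hd : 1 ≤ d) (hN : 2 ≤ N) {β a Λ t : ℝ} (ht : 0 < t)
    (hb : |β| * (2 * ((d : ℝ) - 1)) < 1 / 2)
    (hρ : 6 * ((d : ℝ) - 1) * |β| * (exp a * exp t) / (1 / 2 - |β| * (2 * ((d : ℝ) - 1))) +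
      exp (a / 2) * Λ / Real.sqrt ((N : ℝ) * (1 / 2 - |β| * (2 * ((d : ℝ) - 1)))) < 1) :
    UniformMassGapOnBallZdS d N β a Λ t t (8 * N) := by
  set b : ℝ := |β| * (2 * ((d : ℝ) - 1)) with hbdef
  have hNpos : (0 : ℝ) < N := by exact_mod_cast (show 0 < N by omega)
  have hgap : 0 < 1 / 2 - b := by linarith
  have hP := oneLinkPoincareSUN_bakryEmery hN hb
  have hV := oneLinkVarianceBound_bakryEmery hN hb
  have hc : (0 : ℝ) ≤ 1 / ((N : ℝ) * (1 / 2 - b)) := by positivity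
  have hv : (0 : ℝ) ≤ (N : ℝ) / (1 / 2 - b) := by positivity
  refine uniformMassGapOnBallZdS_of_pair hd (by omega) hc hv le_rfl (fun B hB => hP B hB) (fun B hB => hV B hB)
    ht ?_
  have hsq1 : Real.sqrt (1 / ((N : ℝ) * (1 / 2 - b)) * ((N : ℝ) / (1 / 2 - b))) = 1 / (1 / 2 - b) := by
    rw [show 1 / ((N : ℝ) * (1 / 2 - b)) * ((N : ℝ) / (1 / 2 - b)) = (1 / (1 / 2 - b)) ^ 2 by field_simp,
      Real.sqrt_sq (by positivity)]
  have hsq2 : Real.sqrt (1 / ((N : ℝ) * (1 / 2 - b))) = 1 / Real.sqrt ((N : ℝ) * (1 / 2 - b)) := by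
    rw [Real.sqrt_div' _ (mul_nonneg hNpos.le hgap.le), Real.sqrt_one]
  rw [hsq1, hsq2]
  calc 6 * ((d : ℝ) - 1) * |β| * (exp a * exp t * (1 / (1 / 2 - b))) +
        exp (a / 2) * (1 / Real.sqrt ((N : ℝ) * (1 / 2 - b))) * Λ
      = 6 * ((d : ℝ) - 1) * |β| * (exp a * exp t) / (1 / 2 - b) +
        exp (a / 2) * Λ / Real.sqrt ((N : ℝ) * (1 / 2 - b)) := by ring
    _ < 1 := hρ

/-- **The uniform tier-2 `SU(2)` ball on `ℤ^d`** (sharp pair `(2/3, 8/3)`): `2(d-1)|β_W| e^{a} e^{t} + e^{a/2} √(2/3) Λ < 1`,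
`t > 0` `⇒ UniformMassGapOnBallZdS d 2 (β_W/4) a Λ t t 16` — rate `t`, constant `16 n²`. [folklore] -/
theorem su2_uniformMassGapOnBallZdS (hd : 1 ≤ d) {βW a Λ t : ℝ} (ht : 0 < t)
    (hρ : 2 * ((d : ℝ) - 1) * |βW| * (exp a * exp t) + exp (a / 2) * Real.sqrt (2 / 3) * Λ < 1) :
    UniformMassGapOnBallZdS d 2 (βW / 4) a Λ t t 16 := by
  have hc : (0 : ℝ) ≤ 2 / 3 := by norm_num
  have hP : ∀ B : Matrix (Fin 2) (Fin 2) ℂ, matrixOpNorm B ≤ |βW / 4| * (2 * ((d : ℝ) - 1)) →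
      ∀ (ψ : Matrix.specialUnitaryGroup (Fin 2) ℂ → ℝ) (M : ℝ), 0 ≤ M →
        (∀ x y, |ψ x - ψ y| ≤ M * suFrobDist x y) →
        Var[ψ; (haarProbability (Matrix.specialUnitaryGroup (Fin 2) ℂ)).tilted
          fun g => ((2 : ℕ) : ℝ) * ((g : Matrix (Fin 2) (Fin 2) ℂ) * B).trace.re] ≤ 2 / 3 * M ^ 2 :=
    fun B hB ψ M hM hψ => oneLinkPoincareSUN_two_sharp _ B hB ψ M hM hψ
  have hVB := linVariance_of_poincare (N := 2) hP
  have hv : (0 : ℝ) ≤ 2 / 3 * ((2 : ℕ) : ℝ) ^ 2 := by norm_num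
  have h16 : (8 * ((2 : ℕ) : ℝ) : ℝ) = 16 := by norm_num
  rw [← h16]
  refine uniformMassGapOnBallZdS_of_pair hd (by norm_num) hc hv le_rfl hP hVB ht ?_
  have hsq : Real.sqrt (2 / 3 * (2 / 3 * ((2 : ℕ) : ℝ) ^ 2)) = 4 / 3 := by
    rw [show (2 / 3 * (2 / 3 * ((2 : ℕ) : ℝ) ^ 2) : ℝ) = (4 / 3) ^ 2 by norm_num,
      Real.sqrt_sq (by norm_num)]
  rw [hsq]
  have e : 6 * ((d : ℝ) - 1) * |βW / 4| * (exp a * exp t * (4 / 3)) =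
      2 * ((d : ℝ) - 1) * |βW| * (exp a * exp t) := by
    rw [abs_div, abs_of_pos (by norm_num : (0 : ℝ) < 4)]
    ring
  rw [e]
  exact hρ

/-- The `d = 4` reading: `6|β_W| e^{a} e^{t} + e^{a/2} √(2/3) Λ < 1`, `t > 0`
`⇒ UniformMassGapOnBallZdS 4 2 (β_W/4) a Λ t t 16`. [folklore] -/
theorem su2_uniformMassGapOnBallZdS_dim4 {βW a Λ t : ℝ} (ht : 0 < t)
    (hρ : 6 * |βW| * (exp a * exp t) + exp (a / 2) * Real.sqrt (2 / 3) * Λ < 1) :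
    UniformMassGapOnBallZdS 4 2 (βW / 4) a Λ t t 16 :=
  su2_uniformMassGapOnBallZdS (by norm_num) ht (by
    have h6 : (2 : ℝ) * (((4 : ℕ) : ℝ) - 1) = 6 := by norm_num
    calc 2 * (((4 : ℕ) : ℝ) - 1) * |βW| * (exp a * exp t) + exp (a / 2) * Real.sqrt (2 / 3) * Λ
        = 6 * |βW| * (exp a * exp t) + exp (a / 2) * Real.sqrt (2 / 3) * Λ := by rw [h6]
      _ < 1 := hρ)

/-- **Uniform tier-2 `SU(2)` ball, `d = 4`, sharp-variance lineage (B)** (pair `(2/3, 2)` on `‖B‖_op ≤ 1/4`,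
i.e. `|β_W| ≤ 1/6`; `su2_linVariance_sharp`): `3√3 |β_W| e^{a} e^{t} + e^{a/2} √(2/3) Λ < 1`, `t > 0`
`⇒ UniformMassGapOnBallZdS 4 2 (β_W/4) a Λ t t 16`. [folklore] -/
theorem su2_uniformMassGapOnBallZdS_sharp {βW a Λ t : ℝ} (hβ : |βW| ≤ 1 / 6) (ht : 0 < t)
    (hρ : 3 * Real.sqrt 3 * |βW| * (exp a * exp t) + exp (a / 2) * Real.sqrt (2 / 3) * Λ < 1) :
    UniformMassGapOnBallZdS 4 2 (βW / 4) a Λ t t 16 := by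
  have hc : (0 : ℝ) ≤ 2 / 3 := by norm_num
  have hb : |βW / 4| * (2 * (((4 : ℕ) : ℝ) - 1)) ≤ 1 / 4 := by
    rw [abs_div, abs_of_pos (by norm_num : (0 : ℝ) < 4)]
    norm_num
    linarith
  have hP : ∀ B : Matrix (Fin 2) (Fin 2) ℂ, matrixOpNorm B ≤ 1 / 4 →
      ∀ (ψ : Matrix.specialUnitaryGroup (Fin 2) ℂ → ℝ) (M : ℝ), 0 ≤ M →
        (∀ x y, |ψ x - ψ y| ≤ M * suFrobDist x y) →
        Var[ψ; (haarProbability (Matrix.specialUnitaryGroup (Fin 2) ℂ)).tilted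
          fun g => ((2 : ℕ) : ℝ) * ((g : Matrix (Fin 2) (Fin 2) ℂ) * B).trace.re] ≤ 2 / 3 * M ^ 2 :=
    fun B hB ψ M hM hψ => oneLinkPoincareSUN_two_sharp _ B hB ψ M hM hψ
  have h16 : (8 * ((2 : ℕ) : ℝ) : ℝ) = 16 := by norm_num
  rw [← h16]
  refine uniformMassGapOnBallZdS_of_pair (d := 4) (N := 2) (by norm_num) (by norm_num) hc zero_le_two hb hP
    (su2_linVariance_sharp le_rfl) ht ?_
  have hsq : Real.sqrt (2 / 3 * 2) = 2 * Real.sqrt 3 / 3 := by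
    have h3 : (2 * Real.sqrt 3 / 3) ^ 2 = 2 / 3 * 2 := by
      rw [div_pow, mul_pow, Real.sq_sqrt (by norm_num)]; norm_num
    rw [← h3, Real.sqrt_sq (by positivity)]
  rw [hsq]
  have e : 6 * (((4 : ℕ) : ℝ) - 1) * |βW / 4| * (exp a * exp t * (2 * Real.sqrt 3 / 3)) =
      3 * Real.sqrt 3 * |βW| * (exp a * exp t) := by
    rw [abs_div, abs_of_pos (by norm_num : (0 : ℝ) < 4)]
    ring
  rw [e]
  exact hρ

/-! ### The certified `SU(2)` `ℤ⁴` rows, uniformly: rate `log q`, constant `16 n²` -/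

/-- **Uniform tier-2 row from the numeric majorants** (lineage A; `T` = `exp_le_taylor4`, `√(2/3) ≤ 0.8165`):
at weight `t = log q` (`q > 1`), `6 β_W q T(2ε) + T(ε)·0.8165·ε < 1`
`⇒ UniformMassGapOnBallZdS 4 2 (β_W/4) (2ε) ε (log q) (log q) 16` — RATE `log q`. [folklore] -/
theorem su2_uniformRowS {βW ε q : ℝ} (hq : 1 < q) (hβ : 0 ≤ βW) (hε0 : 0 ≤ ε) (hε1 : ε ≤ 1 / 2)
    (h : 6 * βW * q * (1 + 2 * ε + (2 * ε) ^ 2 / 2 + (2 * ε) ^ 3 / 6 + 5 / 96 * (2 * ε) ^ 4) +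
      (1 + ε + ε ^ 2 / 2 + ε ^ 3 / 6 + 5 / 96 * ε ^ 4) * (8165 / 10000) * ε < 1) :
    UniformMassGapOnBallZdS 4 2 (βW / 4) (2 * ε) ε (Real.log q) (Real.log q) 16 := by
  have hq0 : 0 < q := zero_lt_one.trans hq
  refine su2_uniformMassGapOnBallZdS_dim4 (Real.log_pos hq) ?_
  have h1 := exp_le_taylor4 (x := 2 * ε) (by linarith) (by linarith)
  have h2 := exp_le_taylor4 (x := ε) hε0 (by linarith)
  rw [abs_of_nonneg hβ, show 2 * ε / 2 = ε by ring, Real.exp_log hq0]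
  calc 6 * βW * (exp (2 * ε) * q) + exp ε * Real.sqrt (2 / 3) * ε
      ≤ 6 * βW * ((1 + 2 * ε + (2 * ε) ^ 2 / 2 + (2 * ε) ^ 3 / 6 + 5 / 96 * (2 * ε) ^ 4) * q) +
        (1 + ε + ε ^ 2 / 2 + ε ^ 3 / 6 + 5 / 96 * ε ^ 4) * (8165 / 10000) * ε := by
        gcongr
        · exact sqrt_two_thirds_le
    _ = 6 * βW * q * (1 + 2 * ε + (2 * ε) ^ 2 / 2 + (2 * ε) ^ 3 / 6 + 5 / 96 * (2 * ε) ^ 4) +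
        (1 + ε + ε ^ 2 / 2 + ε ^ 3 / 6 + 5 / 96 * ε ^ 4) * (8165 / 10000) * ε := by ring
    _ < 1 := h

/-- **Uniform tier-2 row, lineage (B)** (`√3 ≤ 1.732051`; `0 ≤ β_W ≤ 1/6`): at weight `log q`,
`3·1.732051·β_W q T(2ε) + T(ε)·0.8165·ε < 1 ⇒ UniformMassGapOnBallZdS 4 2 (β_W/4) (2ε) ε (log q) (log q) 16`. [folklore] -/
theorem su2_uniformRowBS {βW ε q : ℝ} (hq : 1 < q) (hβ : 0 ≤ βW) (hβ6 : βW ≤ 1 / 6) (hε0 : 0 ≤ ε)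
    (hε1 : ε ≤ 1 / 2)
    (h : 3 * (1732051 / 1000000) * βW * q * (1 + 2 * ε + (2 * ε) ^ 2 / 2 + (2 * ε) ^ 3 / 6 + 5 / 96 * (2 * ε) ^ 4) +
      (1 + ε + ε ^ 2 / 2 + ε ^ 3 / 6 + 5 / 96 * ε ^ 4) * (8165 / 10000) * ε < 1) :
    UniformMassGapOnBallZdS 4 2 (βW / 4) (2 * ε) ε (Real.log q) (Real.log q) 16 := by
  have hq0 : 0 < q := zero_lt_one.trans hq
  refine su2_uniformMassGapOnBallZdS_sharp (by rw [abs_of_nonneg hβ]; exact hβ6) (Real.log_pos hq) ?_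
  have h1 := exp_le_taylor4 (x := 2 * ε) (by linarith) (by linarith)
  have h2 := exp_le_taylor4 (x := ε) hε0 (by linarith)
  rw [abs_of_nonneg hβ, show 2 * ε / 2 = ε by ring, Real.exp_log hq0]
  calc 3 * Real.sqrt 3 * βW * (exp (2 * ε) * q) + exp ε * Real.sqrt (2 / 3) * ε
      ≤ 3 * (1732051 / 1000000) * βW * ((1 + 2 * ε + (2 * ε) ^ 2 / 2 + (2 * ε) ^ 3 / 6 + 5 / 96 * (2 * ε) ^ 4) * q) +
        (1 + ε + ε ^ 2 / 2 + ε ^ 3 / 6 + 5 / 96 * ε ^ 4) * (8165 / 10000) * ε := by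
        gcongr
        · exact sqrt_three_le_bound
        · exact sqrt_two_thirds_le
    _ = 3 * (1732051 / 1000000) * βW * q * (1 + 2 * ε + (2 * ε) ^ 2 / 2 + (2 * ε) ^ 3 / 6 + 5 / 96 * (2 * ε) ^ 4) +
        (1 + ε + ε ^ 2 / 2 + ε ^ 3 / 6 + 5 / 96 * ε ^ 4) * (8165 / 10000) * ε := by ring
    _ < 1 := h

/-- Uniform row (S, q = 2): `(β⋆_W, ε) = (1/80, 0.470)`, rate `log 2`, constant `16 n²`. [folklore] -/
theorem su2_uniformRowS2_1_80 :
    UniformMassGapOnBallZdS 4 2 ((1 / 80 : ℝ) / 4) (2 * (47 / 100)) (47 / 100) (Real.log 2) (Real.log 2) 16 :=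
  su2_uniformRowS (by norm_num) (by norm_num) (by norm_num) (by norm_num) (by norm_num)

/-- Uniform row (S, q = 2): `(β⋆_W, ε) = (1/40, 0.346)`, rate `log 2`, constant `16 n²`. [folklore] -/
theorem su2_uniformRowS2_1_40 :
    UniformMassGapOnBallZdS 4 2 ((1 / 40 : ℝ) / 4) (2 * (173 / 500)) (173 / 500) (Real.log 2) (Real.log 2) 16 :=
  su2_uniformRowS (by norm_num) (by norm_num) (by norm_num) (by norm_num) (by norm_num)

/-- Uniform row (S, q = 2): `(β⋆_W, ε) = (1/32, 0.294)`, rate `log 2`, constant `16 n²`. [folklore] -/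
theorem su2_uniformRowS2_1_32 :
    UniformMassGapOnBallZdS 4 2 ((1 / 32 : ℝ) / 4) (2 * (147 / 500)) (147 / 500) (Real.log 2) (Real.log 2) 16 :=
  su2_uniformRowS (by norm_num) (by norm_num) (by norm_num) (by norm_num) (by norm_num)

/-- Uniform row (S, q = 2): `(β⋆_W, ε) = (1/24, 0.219)`, rate `log 2`, constant `16 n²`. [folklore] -/
theorem su2_uniformRowS2_1_24 :
    UniformMassGapOnBallZdS 4 2 ((1 / 24 : ℝ) / 4) (2 * (219 / 1000)) (219 / 1000) (Real.log 2) (Real.log 2) 16 :=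
  su2_uniformRowS (by norm_num) (by norm_num) (by norm_num) (by norm_num) (by norm_num)

/-- Uniform row (S, q = 2): `(β⋆_W, ε) = (1/20, 0.167)`, rate `log 2`, constant `16 n²`. [folklore] -/
theorem su2_uniformRowS2_1_20 :
    UniformMassGapOnBallZdS 4 2 ((1 / 20 : ℝ) / 4) (2 * (167 / 1000)) (167 / 1000) (Real.log 2) (Real.log 2) 16 :=
  su2_uniformRowS (by norm_num) (by norm_num) (by norm_num) (by norm_num) (by norm_num)

/-- Uniform row (S, q = 2): `(β⋆_W, ε) = (1/16, 0.097)`, rate `log 2`, constant `16 n²`. [folklore] -/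
theorem su2_uniformRowS2_1_16 :
    UniformMassGapOnBallZdS 4 2 ((1 / 16 : ℝ) / 4) (2 * (97 / 1000)) (97 / 1000) (Real.log 2) (Real.log 2) 16 :=
  su2_uniformRowS (by norm_num) (by norm_num) (by norm_num) (by norm_num) (by norm_num)

/-- Uniform row (S, q = 3/2): `(β⋆_W, ε) = (1/16, 0.186)`, rate `log (3/2)`, constant `16 n²`. [folklore] -/
theorem su2_uniformRowS32_1_16 :
    UniformMassGapOnBallZdS 4 2 ((1 / 16 : ℝ) / 4) (2 * (93 / 500)) (93 / 500) (Real.log (3 / 2))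
      (Real.log (3 / 2)) 16 :=
  su2_uniformRowS (by norm_num) (by norm_num) (by norm_num) (by norm_num) (by norm_num)

/-- Uniform row (S, q = 3/2): `(β⋆_W, ε) = (1/12, 0.097)`, rate `log (3/2)`, constant `16 n²`. [folklore] -/
theorem su2_uniformRowS32_1_12 :
    UniformMassGapOnBallZdS 4 2 ((1 / 12 : ℝ) / 4) (2 * (97 / 1000)) (97 / 1000) (Real.log (3 / 2))
      (Real.log (3 / 2)) 16 :=
  su2_uniformRowS (by norm_num) (by norm_num) (by norm_num) (by norm_num) (by norm_num)

/-- Uniform row (BS, q = 2): `(β⋆_W, ε) = (1/40, 0.376)`, rate `log 2`, constant `16 n²`. [folklore] -/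
theorem su2_uniformRowBS2_1_40 :
    UniformMassGapOnBallZdS 4 2 ((1 / 40 : ℝ) / 4) (2 * (47 / 125)) (47 / 125) (Real.log 2) (Real.log 2) 16 :=
  su2_uniformRowBS (by norm_num) (by norm_num) (by norm_num) (by norm_num) (by norm_num) (by norm_num)

/-- Uniform row (BS, q = 2): `(β⋆_W, ε) = (1/32, 0.328)`, rate `log 2`, constant `16 n²`. [folklore] -/
theorem su2_uniformRowBS2_1_32 :
    UniformMassGapOnBallZdS 4 2 ((1 / 32 : ℝ) / 4) (2 * (41 / 125)) (41 / 125) (Real.log 2) (Real.log 2) 16 :=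
  su2_uniformRowBS (by norm_num) (by norm_num) (by norm_num) (by norm_num) (by norm_num) (by norm_num)

/-- Uniform row (BS, q = 2): `(β⋆_W, ε) = (1/24, 0.258)`, rate `log 2`, constant `16 n²`. [folklore] -/
theorem su2_uniformRowBS2_1_24 :
    UniformMassGapOnBallZdS 4 2 ((1 / 24 : ℝ) / 4) (2 * (129 / 500)) (129 / 500) (Real.log 2) (Real.log 2) 16 :=
  su2_uniformRowBS (by norm_num) (by norm_num) (by norm_num) (by norm_num) (by norm_num) (by norm_num)

/-- Uniform row (BS, q = 2): `(β⋆_W, ε) = (1/20, 0.209)`, rate `log 2`, constant `16 n²`. [folklore] -/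
theorem su2_uniformRowBS2_1_20 :
    UniformMassGapOnBallZdS 4 2 ((1 / 20 : ℝ) / 4) (2 * (209 / 1000)) (209 / 1000) (Real.log 2) (Real.log 2) 16 :=
  su2_uniformRowBS (by norm_num) (by norm_num) (by norm_num) (by norm_num) (by norm_num) (by norm_num)

/-- **Uniform row (BS, q = 2): `(β⋆_W, ε) = (1/16, 0.143)`, rate `log 2`, constant `16 n²`** — the tier-2 twin of the
headline row, now with ONE rate and ONE constant for the whole weighted ball. [folklore] -/
theorem su2_uniformRowBS2_1_16 :
    UniformMassGapOnBallZdS 4 2 ((1 / 16 : ℝ) / 4) (2 * (143 / 1000)) (143 / 1000) (Real.log 2) (Real.log 2) 16 :=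
  su2_uniformRowBS (by norm_num) (by norm_num) (by norm_num) (by norm_num) (by norm_num) (by norm_num)

/-- Uniform row (BS, q = 2): `(β⋆_W, ε) = (1/12, 0.049)`, rate `log 2`, constant `16 n²`. [folklore] -/
theorem su2_uniformRowBS2_1_12 :
    UniformMassGapOnBallZdS 4 2 ((1 / 12 : ℝ) / 4) (2 * (49 / 1000)) (49 / 1000) (Real.log 2) (Real.log 2) 16 :=
  su2_uniformRowBS (by norm_num) (by norm_num) (by norm_num) (by norm_num) (by norm_num) (by norm_num)

/-- **ALL `N ≥ 2`, `ℤ⁴`, HYPOTHESIS-FREE uniform tier-2 row**: `UniformMassGapOnBallZdS 4 N (1/64) (1/20) (1/10)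
(log (6/5)) (log (6/5)) (8N)` — at 't Hooft coupling `1/64` every member of the weighted ball with oscillation load
`≤ 1/20` and `(6/5)^{‖·‖∞}`-weighted cross load `≤ 1/10` has ONE DLR state clustering at rate `log (6/5)` with constant
`8N n²` (certificate of the landed `suN_rowS_1_64`, verbatim: `(9/13)(6/5) e^{1/20} + e^{1/40}/(10 √(13N/32)) < 1`). [folklore] -/
theorem suN_uniformRowS_1_64 {N : ℕ} (hN : 2 ≤ N) :
    UniformMassGapOnBallZdS 4 N (1 / 64) (1 / 20) (1 / 10) (Real.log (6 / 5)) (Real.log (6 / 5)) (8 * N) := by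
  have hq : exp (Real.log (6 / 5)) = 6 / 5 := Real.exp_log (by norm_num)
  have hN2 : (2 : ℝ) ≤ N := by exact_mod_cast hN
  refine suN_uniformMassGapOnBallZdS_bakryEmery (d := 4) (by norm_num) hN (Real.log_pos (by norm_num))
    (by rw [abs_of_pos (by norm_num : (0 : ℝ) < 1 / 64)]; norm_num) ?_
  rw [hq, abs_of_pos (by norm_num : (0 : ℝ) < 1 / 64)]
  have h1 := exp_le_taylor4 (x := 1 / 20) (by norm_num) (by norm_num)
  have h2 := exp_le_taylor4 (x := 1 / 20 / 2) (by norm_num) (by norm_num)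
  have hgap : (1 / 2 - 1 / 64 * (2 * (((4 : ℕ) : ℝ) - 1))) = 13 / 32 := by norm_num
  rw [hgap]
  have hs : (901 / 1000 : ℝ) ≤ Real.sqrt ((N : ℝ) * (13 / 32)) := by
    refine sqrt_thirteen_sixteenths_ge.trans (Real.sqrt_le_sqrt ?_)
    nlinarith
  have hs0 : (0 : ℝ) < Real.sqrt ((N : ℝ) * (13 / 32)) := by linarith
  have hsecond : exp (1 / 20 / 2) * (1 / 10) / Real.sqrt ((N : ℝ) * (13 / 32)) ≤
      (1 + 1 / 20 / 2 + (1 / 20 / 2) ^ 2 / 2 + (1 / 20 / 2) ^ 3 / 6 + 5 / 96 * (1 / 20 / 2) ^ 4) * (1 / 10) /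
        (901 / 1000) := by
    rw [div_le_div_iff₀ hs0 (by norm_num)]
    have he0 : 0 < exp (1 / 20 / 2) := exp_pos _
    nlinarith [hs, h2, he0]
  have hfirst : 6 * (((4 : ℕ) : ℝ) - 1) * (1 / 64) * (exp (1 / 20) * (6 / 5)) / (13 / 32) ≤
      6 * 3 * (1 / 64) * ((1 + 1 / 20 + (1 / 20) ^ 2 / 2 + (1 / 20) ^ 3 / 6 + 5 / 96 * (1 / 20) ^ 4) * (6 / 5)) /
        (13 / 32) := by
    push_cast
    gcongr
    norm_num
  calc 6 * (((4 : ℕ) : ℝ) - 1) * (1 / 64) * (exp (1 / 20) * (6 / 5)) / (13 / 32) +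
        exp (1 / 20 / 2) * (1 / 10) / Real.sqrt ((N : ℝ) * (13 / 32))
      ≤ 6 * 3 * (1 / 64) * ((1 + 1 / 20 + (1 / 20) ^ 2 / 2 + (1 / 20) ^ 3 / 6 + 5 / 96 * (1 / 20) ^ 4) * (6 / 5)) /
          (13 / 32) +
        (1 + 1 / 20 / 2 + (1 / 20 / 2) ^ 2 / 2 + (1 / 20 / 2) ^ 3 / 6 + 5 / 96 * (1 / 20 / 2) ^ 4) * (1 / 10) /
          (901 / 1000) := add_le_add hfirst hsecond
    _ < 1 := by norm_num

/-! ### The loop-action norm ball, uniformly -/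
/-- **Every `N ≥ 2`, `d = 4`, 't Hooft coupling `1/64`**: every generic Wilson-type loop action with finite carrier fibres and
`‖c‖_{log (6/5)} ≤ 1/40` has ONE DLR state clustering at rate `log (6/5)` with constant `8N n²`:
`UniformMassGapOnLoopBall 4 N (1/64) (log (6/5)) (1/40) (log (6/5)) (8N)`. [folklore] -/
theorem suN_uniformMassGapOnLoopBall_1_64 {N : ℕ} (hN : 2 ≤ N) :
    UniformMassGapOnLoopBall 4 N (1 / 64) (Real.log (6 / 5)) (1 / 40) (Real.log (6 / 5)) (8 * N) :=
  ((suN_uniformRowS_1_64 hN).mono (a' := 2 * (1 / 40)) (Λ' := 1 / 40) (by norm_num) (by norm_num)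
    (Real.log_pos (by norm_num)) le_rfl le_rfl (by positivity)).uniformMassGapOnLoopBall


/-- **`SU(2)`, `d = 4`, `β_W = 1/16`: ONE CORRELATION-LENGTH BOUND FOR THE WHOLE LOOP-ACTION BALL.** Every generic
Wilson-type loop action `loopFamilyAction 2 γ c` on `ℤ⁴` (any family of closed lattice loops with finite carrier
fibres, arbitrary position-dependent couplings) with `‖c‖_{log 2} ≤ 0.143` — i.e.
`∑_{i : e ∈ γ_i} |c_i| ∑_{y ∈ γ_i} mult_i(y) 2^{‖e−y‖_∞} ≤ 0.143` at every link `e` — added to the `SU(2)` Wilson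
action at `β_W = 1/16` has exactly one DLR state, and the connected correlations of Lipschitz cylinder observables
in that state decay at rate `≥ log 2` (`> 0.6931`, tree `Real.log_two_gt_d9`; correlation length `< 1.443`
lattice units) with constant `16 n²`: `UniformMassGapOnLoopBall 4 2 ((1/16)/4) (log 2) (143/1000) (log 2) 16`. [folklore] -/
theorem su2_uniformMassGapOnLoopBall_1_16 :
    UniformMassGapOnLoopBall 4 2 ((1 / 16 : ℝ) / 4) (Real.log 2) (143 / 1000) (Real.log 2) 16 :=
  su2_uniformRowBS2_1_16.uniformMassGapOnLoopBall

/-- **`SU(2)`, `d = 4`, `β_W = 1/20`**: radius `0.209` at weight `2^{dist}`, rate `log 2`, constant `16 n²`. [folklore] -/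
theorem su2_uniformMassGapOnLoopBall_1_20 :
    UniformMassGapOnLoopBall 4 2 ((1 / 20 : ℝ) / 4) (Real.log 2) (209 / 1000) (Real.log 2) 16 :=
  su2_uniformRowBS2_1_20.uniformMassGapOnLoopBall

/-- **`SU(2)`, `d = 4`, `β_W = 1/16`, slower weight `(3/2)^{dist}`**: radius `0.186`, rate `log (3/2)`. [folklore] -/
theorem su2_uniformMassGapOnLoopBall32_1_16 :
    UniformMassGapOnLoopBall 4 2 ((1 / 16 : ℝ) / 4) (Real.log (3 / 2)) (93 / 500) (Real.log (3 / 2)) 16 :=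
  su2_uniformRowS32_1_16.uniformMassGapOnLoopBall

/-- The member-level reading at `β_W = 1/16`: every loop action with finite carrier fibres and `‖c‖_{log 2} ≤ 0.143`
has `PerturbedClusteringS 4 2 ((1/16)/4) (loopFamilyAction 2 γ c) (log 2) 16` for EVERY DLR state. [folklore] -/
theorem su2_loopFamily_clustering_1_16 {ι : Type} {γ : ι → ZdLoop 4} {c : ι → ℝ}
    (hfin : ∀ X, {i | walkEdges (γ i).walk = X}.Finite) (h : LoopNormLE (Real.log 2) γ c (143 / 1000)) :
    PerturbedClusteringS 4 2 ((1 / 16 : ℝ) / 4) (loopFamilyAction (d := 4) 2 γ c) (Real.log 2) 16 :=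
  (su2_uniformMassGapOnLoopBall_1_16.2 ι γ c hfin h).2

end Summit.Ventures.YMGap.RobustBall

end
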